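import Mathlib

/-!
# T5CongruentRootOfUnity — a root of unity congruent to `1` modulo `N ≥ 3` is `1`

The arithmetic heart of «`Γ(N)` is neat for `N > 2`» (DR15 Lemma 1.4; the Prop
`DR15Lemma14Shape` of the Tier-3 annex, Neat.lean): if `ζ ∈ ℂ` is a root of unity of the form
`ζ = 1 + N·w` with `w` an algebraic integer and `N ≥ 3`, then `ζ = 1`.

Proof (Minkowski's argument): if `ζ ≠ 1` then `w ≠ 0`; in the number field `L = ℚ(w)` the norm
`N_{L/ℚ}(ζ − 1) = N^{[L:ℚ]} · N_{L/ℚ}(w)` is `N^{[L:ℚ]}` times a NON-ZERO integer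
(`Algebra.isIntegral_norm`, `IsIntegrallyClosed ℤ`), while `|N_{L/ℚ}(ζ − 1)| = ∏_σ |σ(ζ) − 1|
≤ 2^{[L:ℚ]}` because every `σ(ζ)` is a root of unity (`Algebra.norm_eq_prod_embeddings`,
`AlgHom.card`); so `N^{[L:ℚ]} ≤ 2^{[L:ℚ]}` and `N ≤ 2`.

* `norm_eq_one_of_pow_eq_one`, `norm_sub_one_le_two` — the archimedean bounds;
* `exists_int_norm_eq` — the norm of an algebraic integer of a number field is an integer;
* **`eq_one_of_pow_eq_one_of_eq_one_add_mul`** — the statement above;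
* `eq_one_of_pow_eq_one_of_sub_one_eq_mul` — the same with `ζ − 1 = N·w`.
-/

namespace Summit.Ventures.HodgeRepro2.T5CongruentRootOfUnity

open IntermediateField Module

/-- A root of unity in `ℂ` has norm `1`. -/
theorem norm_eq_one_of_pow_eq_one {z : ℂ} {n : ℕ} (hn : 0 < n) (h : z ^ n = 1) : ‖z‖ = 1 := by
  have : ‖z‖ ^ n = 1 := by rw [← norm_pow, h, norm_one]
  exact (pow_eq_one_iff_of_nonneg (norm_nonneg z) hn.ne').mp this

/-- `‖z − 1‖ ≤ 2` for `‖z‖ = 1`. -/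
theorem norm_sub_one_le_two {z : ℂ} (hz : ‖z‖ = 1) : ‖z - 1‖ ≤ 2 := by
  calc ‖z - 1‖ ≤ ‖z‖ + ‖(1 : ℂ)‖ := norm_sub_le z 1
    _ = 2 := by rw [hz, norm_one]; norm_num

/-- The norm down to `ℚ` of an element of a finite extension of `ℚ` that is integral over `ℤ` is
an integer. -/
theorem exists_int_norm_eq {L : Type*} [Field L] [Algebra ℚ L] {x : L}
    (hx : IsIntegral ℤ x) : ∃ a : ℤ, (a : ℚ) = Algebra.norm ℚ x := by
  have h : IsIntegral ℤ (Algebra.norm ℚ x) := Algebra.isIntegral_norm ℚ hx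
  obtain ⟨a, ha⟩ := IsIntegrallyClosed.isIntegral_iff.mp h
  exact ⟨a, by simpa using ha⟩

/-- **A root of unity congruent to `1` modulo `N ≥ 3` is `1`.** If `ζ = 1 + N·w` with `w`
integral over `ℤ`, `3 ≤ N`, and `ζ^n = 1` for some `n > 0`, then `ζ = 1`. -/
theorem eq_one_of_pow_eq_one_of_eq_one_add_mul {ζ w : ℂ} (hw : IsIntegral ℤ w) {N : ℕ}
    (hN : 3 ≤ N) (hζ : ζ = 1 + (N : ℂ) * w) {n : ℕ} (hn : 0 < n) (hpow : ζ ^ n = 1) :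
    ζ = 1 := by
  by_contra hne
  have hw0 : w ≠ 0 := by
    intro h0
    exact hne (by rw [hζ, h0, mul_zero, add_zero])
  -- the number field `L = ℚ(w)`
  have hwalg : IsIntegral ℚ w := hw.tower_top
  let L : IntermediateField ℚ ℂ := ℚ⟮w⟯
  haveI : FiniteDimensional ℚ L := adjoin.finiteDimensional hwalg
  let w' : L := ⟨w, mem_adjoin_simple_self ℚ w⟩
  have hw' : IsIntegral ℤ w' := by
    rw [← isIntegral_algebraMap_iff (algebraMap L ℂ).injective]
    exact hw
  have hw'0 : w' ≠ 0 := by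
    intro h
    exact hw0 (congrArg Subtype.val h)
  -- the norm of `w'` is a non-zero integer
  obtain ⟨a, ha⟩ := exists_int_norm_eq hw'
  have ha0 : a ≠ 0 := by
    intro h0
    rw [h0, Int.cast_zero] at ha
    exact (Algebra.norm_ne_zero_iff.mpr hw'0) ha.symm
  have ha1 : (1 : ℝ) ≤ |(a : ℝ)| := by
    have : (1 : ℤ) ≤ |a| := Int.one_le_abs ha0
    exact_mod_cast this
  -- `ζ` inside `L`
  let ζ' : L := 1 + (N : L) * w'
  have hζ' : (ζ' : ℂ) = ζ := by simp [ζ', w', hζ]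
  have hζ'pow : ζ' ^ n = 1 := by
    apply Subtype.ext
    simp only [SubmonoidClass.coe_pow, OneMemClass.coe_one]
    rw [hζ', hpow]
  -- the norm of `ζ' − 1`
  have hsub : ζ' - 1 = algebraMap ℚ L (N : ℚ) * w' := by
    simp [ζ']
  set d := finrank ℚ L with hd
  have hnorm : Algebra.norm ℚ (ζ' - 1) = (N : ℚ) ^ d * (a : ℚ) := by
    rw [hsub, map_mul, Algebra.norm_algebraMap, ha]
  -- the archimedean bound through the embeddings
  have hbound : ‖(algebraMap ℚ ℂ) (Algebra.norm ℚ (ζ' - 1))‖ ≤ 2 ^ d := by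
    rw [Algebra.norm_eq_prod_embeddings ℚ ℂ, norm_prod]
    calc ∏ σ : L →ₐ[ℚ] ℂ, ‖σ (ζ' - 1)‖ ≤ ∏ _σ : L →ₐ[ℚ] ℂ, (2 : ℝ) := by
          apply Finset.prod_le_prod (fun _ _ => norm_nonneg _)
          intro σ _
          rw [map_sub, map_one]
          apply norm_sub_one_le_two
          apply norm_eq_one_of_pow_eq_one hn
          rw [← map_pow, hζ'pow, map_one]
      _ = 2 ^ d := by rw [Finset.prod_const, Finset.card_univ, AlgHom.card]
  -- compare: `N^d · |a| ≤ 2^d`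
  have hval : ‖(algebraMap ℚ ℂ) (Algebra.norm ℚ (ζ' - 1))‖ = (N : ℝ) ^ d * |(a : ℝ)| := by
    rw [hnorm, map_mul, map_pow, norm_mul, norm_pow]
    simp only [eq_ratCast, Rat.cast_natCast, Rat.cast_intCast, Complex.norm_natCast,
      Complex.norm_intCast]
  have hd0 : 0 < d := finrank_pos
  have hNd : (N : ℝ) ^ d ≤ 2 ^ d := by
    calc (N : ℝ) ^ d = (N : ℝ) ^ d * 1 := (mul_one _).symm
      _ ≤ (N : ℝ) ^ d * |(a : ℝ)| := by
          apply mul_le_mul_of_nonneg_left ha1 (pow_nonneg (Nat.cast_nonneg N) d)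
      _ = ‖(algebraMap ℚ ℂ) (Algebra.norm ℚ (ζ' - 1))‖ := hval.symm
      _ ≤ 2 ^ d := hbound
  have hN2 : (N : ℝ) ≤ 2 := by
    exact le_of_pow_le_pow_left₀ hd0.ne' (by norm_num) hNd
  have : (3 : ℝ) ≤ N := by exact_mod_cast hN
  linarith

/-- The same, with the congruence written as `ζ − 1 = N·w`. -/
theorem eq_one_of_pow_eq_one_of_sub_one_eq_mul {ζ w : ℂ} (hw : IsIntegral ℤ w) {N : ℕ}
    (hN : 3 ≤ N) (hζ : ζ - 1 = (N : ℂ) * w) {n : ℕ} (hn : 0 < n) (hpow : ζ ^ n = 1) :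
    ζ = 1 :=
  eq_one_of_pow_eq_one_of_eq_one_add_mul hw hN (by rw [← hζ]; ring) hn hpow

end Summit.Ventures.HodgeRepro2.T5CongruentRootOfUnity
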